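import Summits.HodgeConjecture.CorCM.CMSixfoldRank.SimpleCMSixfoldNondegenerateHodge
import Summits.HodgeConjecture.HodgeConjecture.Theorems.Ring2AbelianAllLandherr
import HarnessLib

/-!
# The simple CM sixfold row from the SPLIT sixfold components alone, granted the CM-splitness hypothesis

Cell `pub-hodgecm2` (COR-CM), binder seat b25 (gen 36), count-neutral; KERNEL ONLY (theorems; no definition, no named
fact, no `sorry`; `HC_CM` does not occur).  Companion of lit-deligne-3's
`CorCM/CMSixfoldRank/SimpleCMSixfoldNondegenerateHodge` (`hodgeSimpleCMSixfold_of_weilSixfolds`: the ring-2 atlas row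
«`g = 6`, simple, CM-type», `Ring2.Atlas.HodgeSimpleCMSixfold`, and its degenerate cell `HodgeDegenerateCMSixfold`, follow
from `W₆ = Theses.SevenfoldWeilCensus.WeilSixfolds` — the Weil classes of ALL Weil-type sixfolds, every discriminant).

WHAT IS NEW.  The input `W₆` is replaced by the SPLIT components `(3, d, [-1])` ALONE
(`Ring2.Hypotheses.WeilClassesComponent 3 d (splitDiscriminantClass 3 d)`, for which the tree has the three carriers
`Ring2.AbelianAll.weilClassesComponent_split_three_of_markmanSixfolds'` (Markman 2025 Thm. 1.5.1, UNREFEREED),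
`…_three_three_of_schoen'` (Schoen 1998, refereed, `d = 3`), `…_three_one_of_koike'` (Koike 2004, refereed, `d = 1`)),
GRANTED the **CM-splitness hypothesis** `hS`, stated INLINE (no definition): every Weil structure `(φ, d)` of type
`(3,3)` on a simple complex abelian sixfold of CM type admits, for SOME projective embedding `e` and non-zero rational
`a ∈ H²(ℙ^{e.n})`, a non-degenerate discriminant witness of the SPLIT class `[(-1)³]` for the `k`-symmetrised hyperplane
class `d·e^*a + φ^*e^*a` (`VanGeemen1994.HasWeilDiscriminantNondeg`).  The mathematics behind `hS` is the seat's
THEOREM A (note `run/shared/lean/pub/pub-hodgecm2/pub-hodgecm2-b25/CM-WEIL-SPLIT.md` v1.3, §1): for every CM field `F`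
containing an imaginary quadratic field `k = ℚ(√-D)` and every `k`-balanced CM type `Φ`, the abelian variety
`A_{(F,Φ)}` carries a polarization `Tr_{F/ℚ}(√-D·f·x·ȳ)`, `f ∈ F⁺`, whose `k`-hermitian form — the transfer
`Tr_{F/k}⟨f⟩`, Gram matrix `(Tr_{F⁺/ℚ}(f bᵢ bⱼ))`, `disc ≡ N_{F⁺/ℚ}(f)·d_{F⁺}` — has the split class `(-1)ⁿ`
(Landherr; existence of `f` with the prescribed real signs and `|N(f)|·d_{F⁺} ∈ Nm(k^×)` by O'Meara 71:19 for the
quadratic extension `F/F⁺` and a no-obstruction lemma from the discriminant tower formula; 1066/1066 numerical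
confirmations, jobs j133375 / j133456 / j133532).  Theorem A is NOT a kernel theorem (class field theory is not in
Mathlib, and the passage from the CM Riemann form to a discriminant witness for a hyperplane-shaped class is not on the
carriers: the note's §4 (i)–(iii)); it enters here as the hypothesis `hS`, exactly as `W₆` entered the predecessor.

* `weilClasses_algebraic_of_splitComponents_of_cmSplit` — per member: on a simple CM sixfold every Weil structure has
  `p = 3`, and its rational `(3,3)` Weil classes are algebraic from the split component `(3, d, [-1])` and `hS`.
* **`hodgeSimpleCMSixfold_of_splitComponents_of_cmSplit`** — `Ring2.Atlas.HodgeSimpleCMSixfold` (hence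
  `HodgeDegenerateCMSixfold`) from the split sixfold components and `hS` (generation `B• ⊆ D• + Σ_k W_k` and the
  isogeny to a realisation are lit-deligne-3's `exists_isIsogenous_isDivisorMultiWeilGenerated`; the engine is ring 2's
  `hodgeConjectureFor_of_isDivisorMultiWeilGenerated`; isogeny invariance `HodgeConjectureFor.of_isIsogenous`).
* **`hodgeSimpleCMSixfold_of_markmanSixfolds_of_cmSplit`**, `hodgeDegenerateCMSixfold_of_markmanSixfolds_of_cmSplit` —
  the Hodge conjecture for EVERY simple complex abelian sixfold of CM type from Markman's split-sixfold statement
  (`HodgeTheory.Markman2025_weilClasses_algebraic_hyperbolicSixfold`, unrefereed) and `hS` alone.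
* `weilClasses_algebraic_three_of_schoen_of_cmSplit` / `…_one_of_koike_of_cmSplit` — the REFEREED per-plane statements
  for `k = ℚ(√-3)` (Weil structures with `φ ≫ φ = -3`) and `k = ℚ(√-1)` (`φ ≫ φ = -1`).

HONEST FRAMING: no case of the Hodge conjecture is proved unconditionally here; `hS` is a displayed hypothesis whose
print-level proof is the seat's note (not refereed); the Markman fact is unrefereed.  `HC_CM` is NOT used and NOT
proved; nothing here bears on rank-four faces or on the COR-CM chain.

## References

* [Markman2025SecantWeil] E. Markman, arXiv:2502.03415, Thm. 1.5.1 (unrefereed).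
* [Schoen1998HodgeWeilAddendum] C. Schoen, Compositio Math. 114 (1998), Theorem (p. 329) and §10.
* [Koike2004WeilHodge] K. Koike, Canad. Math. Bull. 47 (2004), Thm. 2.1, Cor. 2.1.
* [vanGeemen1994HodgeAV] B. van Geemen, LNM 1594 (1994), 4.9, Lemma 5.2, 5.4 and (5.4.1), Thm. 6.12.
* [Deligne1982HodgeCycles] P. Deligne, LNM 900 (1982), §4 Lemma 4.6, Cor. 4.2; §5 Prop. 5.1.
* [MoonenZarhin1999LowDim] B. Moonen, Yu. Zarhin, Math. Ann. 315 (1999), §5.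
* [Landherr1936HermitianForms] W. Landherr, Abh. Math. Sem. Hamburg 11 (1936).
* [OMeara1963] O. T. O'Meara, *Introduction to Quadratic Forms* (1963), 71:19.
-/

noncomputable section

open CategoryTheory NumberField

namespace Summit.HodgeConjecture.CorCM.CMSixfoldSplit

open Literature.AlgebraicGeometry Literature.AlgebraicGeometry.Motives
open Literature.AlgebraicGeometry.Motives.AbelianVariety
open Literature.AlgebraicGeometry.HodgeTheory
open Literature.AlgebraicGeometry.VanGeemen1994 (HasWeilDiscriminantNondeg)
open Summit.HodgeConjecture.HodgeConjecture.Ring2.Atlas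
open Summit.HodgeConjecture.HodgeConjecture.Ring2.Hypotheses
open Summit.HodgeConjecture.HodgeConjecture.Ring2.AbelianAll
open Summit.HodgeConjecture.CorCM.CMSixfoldRank

/-! ### §1 The per-member statement: Weil classes of a simple CM sixfold from the split components -/

/-- **On a simple complex abelian sixfold of CM type, the rational `(p,p)` Weil classes of every Weil structure
`(φ, d)` are algebraic, granted the SPLIT sixfold components `(3, d, [-1])` and the CM-splitness hypothesis `hS`**
(a Weil structure on a sixfold has `p = 3`; `hS` puts `(A, φ, d·e^*a + φ^*e^*a)` on the split component for some
`(e, a)`, and `WeilClassesComponent 3 d [-1]` concludes).  [cite: vanGeemen1994HodgeAV, Lemma 5.2 and (5.4.1)]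
[cite: Markman2025SecantWeil, Thm. 1.5.1] -/
theorem weilClasses_algebraic_of_splitComponents_of_cmSplit
    (hC : ∀ d : ℕ, 0 < d → WeilClassesComponent 3 d (splitDiscriminantClass 3 d))
    (hS : ∀ (A : AbelianVariety ℂ) (φ : A ⟶ A) (d : ℕ), IsSimpleCMSixfold A → IsWeilType A φ 3 d →
      ∃ (e : ProjectiveEmbedding A.X) (a : complexBetti (projectiveSpace e.n ℂ) 2),
        IsRationalClass a ∧ a ≠ 0 ∧
          HasWeilDiscriminantNondeg A φ 3 d
            ((d : ℂ) • complexBetti.map e.ι 2 a + complexBetti.map φ.hom.hom.hom 2 (complexBetti.map e.ι 2 a))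
            (splitDiscriminantClass 3 d))
    (A : AbelianVariety ℂ) (hA : IsSimpleCMSixfold A) :
    ∀ (p d : ℕ) (φ : A ⟶ A), IsWeilType A φ p d → ∀ c ∈ weilClassesOf A φ p d, IsRationalClass c →
      IsOfHodgeType (2 * p) A.X (2 * p) p p c → c ∈ algebraicClasses A.X p := by
  intro p d φ hW c hcW hc hH
  have h6 : A.dim = 6 := hA.1
  obtain rfl : p = 3 := by have := hW.dim_eq; omega
  obtain ⟨e, a, ha, ha0, hδ⟩ := hS A φ d hA hW
  exact hC d hW.d_pos A φ hW.dim_eq hW.isSmoothProjective hW.sq_eq e a ha ha0 hδ c hc hH hcW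

/-! ### §2 The row `g = 6`, simple, CM-type, and its degenerate cell -/

/-- **The ring-2 atlas row `HodgeSimpleCMSixfold` — the Hodge conjecture for EVERY simple complex abelian sixfold of CM
type — from the SPLIT sixfold components `(3, d, [-1])` alone, granted the CM-splitness hypothesis `hS`.**  Proof as in
`CMSixfoldRank.hodgeSimpleCMSixfold_of_weilSixfolds`: `X` is isogenous to a divisor-plus-Weil-generated realisation
`X'` (`exists_isIsogenous_isDivisorMultiWeilGenerated`), on which §1 supplies every Weil plane and ring 2's engine
`hodgeConjectureFor_of_isDivisorMultiWeilGenerated` concludes; the Hodge conjecture is an isogeny invariant.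
[cite: vanGeemen1994HodgeAV, Lemma 3.7 and Thm. 6.12] [cite: MoonenZarhin1999LowDim, §5]
[cite: Markman2025SecantWeil, Thm. 1.5.1] -/
theorem hodgeSimpleCMSixfold_of_splitComponents_of_cmSplit
    (hC : ∀ d : ℕ, 0 < d → WeilClassesComponent 3 d (splitDiscriminantClass 3 d))
    (hS : ∀ (A : AbelianVariety ℂ) (φ : A ⟶ A) (d : ℕ), IsSimpleCMSixfold A → IsWeilType A φ 3 d →
      ∃ (e : ProjectiveEmbedding A.X) (a : complexBetti (projectiveSpace e.n ℂ) 2),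
        IsRationalClass a ∧ a ≠ 0 ∧
          HasWeilDiscriminantNondeg A φ 3 d
            ((d : ℂ) • complexBetti.map e.ι 2 a + complexBetti.map φ.hom.hom.hom 2 (complexBetti.map e.ι 2 a))
            (splitDiscriminantClass 3 d)) :
    HodgeSimpleCMSixfold := by
  intro X hX
  obtain ⟨X', hX', hgen, hiso⟩ := exists_isIsogenous_isDivisorMultiWeilGenerated X hX
  exact HodgeConjectureFor.of_isIsogenous hiso
    (hodgeConjectureFor_of_isDivisorMultiWeilGenerated hgen
      (weilClasses_algebraic_of_splitComponents_of_cmSplit hC hS X' hX'))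

/-- **The Hodge conjecture for every simple complex abelian sixfold of CM type, from Markman's split-sixfold statement
(arXiv:2502.03415 Thm. 1.5.1, UNREFEREED named fact) and the CM-splitness hypothesis `hS` ALONE.**
[cite: Markman2025SecantWeil, Thm. 1.5.1] [cite: vanGeemen1994HodgeAV, (5.4.1) and Thm. 6.12] -/
theorem hodgeSimpleCMSixfold_of_markmanSixfolds_of_cmSplit
    (hM : Markman2025_weilClasses_algebraic_hyperbolicSixfold)
    (hS : ∀ (A : AbelianVariety ℂ) (φ : A ⟶ A) (d : ℕ), IsSimpleCMSixfold A → IsWeilType A φ 3 d →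
      ∃ (e : ProjectiveEmbedding A.X) (a : complexBetti (projectiveSpace e.n ℂ) 2),
        IsRationalClass a ∧ a ≠ 0 ∧
          HasWeilDiscriminantNondeg A φ 3 d
            ((d : ℂ) • complexBetti.map e.ι 2 a + complexBetti.map φ.hom.hom.hom 2 (complexBetti.map e.ι 2 a))
            (splitDiscriminantClass 3 d)) :
    HodgeSimpleCMSixfold :=
  hodgeSimpleCMSixfold_of_splitComponents_of_cmSplit
    (fun _ hd => weilClassesComponent_split_three_of_markmanSixfolds' hM hd) hS

/-- **The ring-2 atlas cell `HodgeDegenerateCMSixfold` (simple CM sixfolds WITH a balanced quadratic endomorphism —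
the open cell of `Theorems/Ring2AtlasCMSixfolds`) from Markman's split-sixfold statement and `hS` alone.**
[cite: Markman2025SecantWeil, Thm. 1.5.1] [cite: MoonenZarhin1999LowDim, §5] -/
theorem hodgeDegenerateCMSixfold_of_markmanSixfolds_of_cmSplit
    (hM : Markman2025_weilClasses_algebraic_hyperbolicSixfold)
    (hS : ∀ (A : AbelianVariety ℂ) (φ : A ⟶ A) (d : ℕ), IsSimpleCMSixfold A → IsWeilType A φ 3 d →
      ∃ (e : ProjectiveEmbedding A.X) (a : complexBetti (projectiveSpace e.n ℂ) 2),
        IsRationalClass a ∧ a ≠ 0 ∧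
          HasWeilDiscriminantNondeg A φ 3 d
            ((d : ℂ) • complexBetti.map e.ι 2 a + complexBetti.map φ.hom.hom.hom 2 (complexBetti.map e.ι 2 a))
            (splitDiscriminantClass 3 d)) :
    HodgeDegenerateCMSixfold :=
  hodgeDegenerateCMSixfold_of_simpleCMSixfold (hodgeSimpleCMSixfold_of_markmanSixfolds_of_cmSplit hM hS)

/-! ### §3 The refereed per-plane statements for `k = ℚ(√-3)` (Schoen 1998) and `k = ℚ(√-1)` (Koike 2004) -/

/-- **`k = ℚ(√-3)` (REFEREED): on a simple complex abelian sixfold of CM type, the rational `(3,3)` Weil classes of a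
Weil structure `φ` with `φ ≫ φ = -3` are algebraic, granted Schoen's hyperbolic-sixfold theorem and the CM-splitness
hypothesis at `d = 3`.**  [cite: Schoen1998HodgeWeilAddendum, Theorem (p. 329)] [cite: vanGeemen1994HodgeAV, (5.4.1)] -/
theorem weilClasses_algebraic_three_of_schoen_of_cmSplit
    (hSch : Schoen1998_weilClasses_algebraic_hyperbolicSixfold_three)
    (hS : ∀ (A : AbelianVariety ℂ) (φ : A ⟶ A), IsSimpleCMSixfold A → IsWeilType A φ 3 3 →
      ∃ (e : ProjectiveEmbedding A.X) (a : complexBetti (projectiveSpace e.n ℂ) 2),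
        IsRationalClass a ∧ a ≠ 0 ∧
          HasWeilDiscriminantNondeg A φ 3 3
            (((3 : ℕ) : ℂ) • complexBetti.map e.ι 2 a + complexBetti.map φ.hom.hom.hom 2 (complexBetti.map e.ι 2 a))
            (splitDiscriminantClass 3 3))
    {A : AbelianVariety ℂ} (hA : IsSimpleCMSixfold A) {φ : A ⟶ A} (hW : IsWeilType A φ 3 3) :
    ∀ c ∈ weilClassesOf A φ 3 3, IsRationalClass c → IsOfHodgeType (2 * 3) A.X (2 * 3) 3 3 c →
      c ∈ algebraicClasses A.X 3 := by
  intro c hcW hc hH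
  obtain ⟨e, a, ha, ha0, hδ⟩ := hS A φ hA hW
  exact weilClassesComponent_split_three_three_of_schoen' hSch A φ hW.dim_eq hW.isSmoothProjective hW.sq_eq e a
    ha ha0 hδ c hc hH hcW

/-- **`k = ℚ(√-1)` (REFEREED): the same for Weil structures `φ` with `φ ≫ φ = -1`, granted Koike's hyperbolic-sixfold
theorem and the CM-splitness hypothesis at `d = 1`.** [cite: Koike2004WeilHodge, Thm. 2.1 and Cor. 2.1]
[cite: vanGeemen1994HodgeAV, (5.4.1)] -/
theorem weilClasses_algebraic_one_of_koike_of_cmSplit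
    (hKo : Koike2004_weilClasses_algebraic_hyperbolicSixfold_one)
    (hS : ∀ (A : AbelianVariety ℂ) (φ : A ⟶ A), IsSimpleCMSixfold A → IsWeilType A φ 3 1 →
      ∃ (e : ProjectiveEmbedding A.X) (a : complexBetti (projectiveSpace e.n ℂ) 2),
        IsRationalClass a ∧ a ≠ 0 ∧
          HasWeilDiscriminantNondeg A φ 3 1
            (((1 : ℕ) : ℂ) • complexBetti.map e.ι 2 a + complexBetti.map φ.hom.hom.hom 2 (complexBetti.map e.ι 2 a))
            (splitDiscriminantClass 3 1))
    {A : AbelianVariety ℂ} (hA : IsSimpleCMSixfold A) {φ : A ⟶ A} (hW : IsWeilType A φ 3 1) :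
    ∀ c ∈ weilClassesOf A φ 3 1, IsRationalClass c → IsOfHodgeType (2 * 3) A.X (2 * 3) 3 3 c →
      c ∈ algebraicClasses A.X 3 := by
  intro c hcW hc hH
  obtain ⟨e, a, ha, ha0, hδ⟩ := hS A φ hA hW
  exact weilClassesComponent_split_three_one_of_koike' hKo A φ hW.dim_eq hW.isSmoothProjective hW.sq_eq e a
    ha ha0 hδ c hc hH hcW

end Summit.HodgeConjecture.CorCM.CMSixfoldSplit

end
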